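import Summits.CriticalPhenomena.SAWScalingLimit.Theses.SAWDefectDecoherence
import Summits.CriticalPhenomena.SAWScalingLimit.Theorems.MassRatio.Negative.Tools
import Literature.Probability.LatticeModels.TriangularLatticeProofs
import HarnessLib

/-!
# Necessity of the local `L¹` law (crux `BoundaryClosureR`, stmt-CriticalPhenomena-14004,
stub `stub_localL1Bound`): Banach–Steinhaus

For a FIXED family of domains `Λ δ`, roots `e δ` and normalisers `b δ`, write
`F_δ = F(e δ, ·, x_c, 5/8)` and `N_δ(ψ) := δ² (Σ_{z ∈ Ω_δ} ψ(δ·mid z) F_δ(z)) / F_δ(b δ)` for the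
normalised bulk functional of the crux target.  THEOREM (`localL1Bound_of_eventually_bounded`,
registered as `stub_localL1Bound_necessity`): if `U ⊆ ℂ` is open, `F_δ(b δ) ≠ 0` eventually, and for
EVERY continuous compactly supported `ψ` with `tsupport ψ ⊆ U` the numbers `‖N_δ(ψ)‖` are eventually
bounded along `𝓝[>] 0` (by a `ψ`-dependent constant — weaker than the convergence the target asserts),
then for every compact `K ⊆ U` the local `L¹` law holds:
`∃ C, ∀ᶠ δ, δ² Σ_{z ∈ Ω_δ, δ·mid z ∈ K} ‖F_δ(z)‖ ≤ C ‖F_δ(b δ)‖`.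
So the stub `LocalL1Bound` is NECESSARY for the target `HexObservableLimitR` (continuous test
functions), not only convenient.

Proof.  If not, some sequence `δ_n → 0⁺` has `L¹`-mass `> n ‖F_{δ_n}(b)‖` with `F_{δ_n}(b) ≠ 0`.
Fix a compact `L` with `K ⊆ L° ⊆ L ⊆ U` and a continuous cutoff `χ ∈ [0,1]`, `χ = 1` on `K`, `χ = 0`
off `L°`.  On the Banach space `ℂ →ᵇ ℂ` the maps `T_n φ := N_{δ_n}(χ φ)` are finite sums of point
evaluations, hence continuous linear; each `χ φ` is an admissible test function, so `(T_n φ)_n` is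
bounded for every `φ` and Banach–Steinhaus (`banach_steinhaus`) bounds `‖T_n‖` uniformly.  But
`‖T_n‖ ≥ Σ_z ‖coefficient_z‖ ≥ δ_n² Σ_{δ_n·mid z ∈ K} ‖F(z)‖/‖F(b)‖`: test against a bounded continuous
`φ`, `‖φ‖ ≤ 1`, interpolating the conjugate phases at the finitely many DISTINCT points `δ_n·mid z`
(tents of a separating radius, `exists_bcf_interpolate`; distinctness = injectivity of `hexMidpoint`
on the edges of `ℍ`, `hexMidpoint_injOn_edgeSet`, by brick coordinates) — contradiction.
-/

noncomputable section

open scoped BigOperators Topology ComplexConjugate BoundedContinuousFunction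
open Filter Set
open Literature.Probability.LatticeModels Literature.Probability.RandomPlanarGeometry
open Literature.Probability.RandomPlanarGeometry.SAW
open Summit.CriticalPhenomena.SAWScalingLimit.Theorems.MassRatio.Negative
  (hexDomainMidEdges_finite mid_re mid_im hexCenter_im pos row)

namespace Summit.CriticalPhenomena.SAWScalingLimit.Theorems.PickHalfPlane.LocalL1

/-! ### 1. Interpolation at finitely many points by bounded continuous functions of norm `≤ 1` -/

/-- A finite set of points of `ℂ` has a separating radius: distinct points are `≥ 2r` apart. -/
theorem exists_sep_radius (P : Finset ℂ) :
    ∃ r : ℝ, 0 < r ∧ ∀ w ∈ P, ∀ w' ∈ P, w ≠ w' → 2 * r ≤ dist w w' := by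
  classical
  by_cases hne : ((P ×ˢ P).filter (fun q : ℂ × ℂ => q.1 ≠ q.2)).Nonempty
  · obtain ⟨q, hq, hmin⟩ := Finset.exists_min_image _ (fun q : ℂ × ℂ => dist q.1 q.2) hne
    have hq' : q.1 ≠ q.2 := (Finset.mem_filter.1 hq).2
    refine ⟨dist q.1 q.2 / 2, by linarith [dist_pos.2 hq'], fun w hw w' hw' hne' => ?_⟩
    have h := hmin (w, w') (Finset.mem_filter.2 ⟨Finset.mk_mem_product hw hw', hne'⟩)
    linarith
  · refine ⟨1, one_pos, fun w hw w' hw' hne' => ?_⟩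
    exact absurd ⟨(w, w'), Finset.mem_filter.2 ⟨Finset.mk_mem_product hw hw', hne'⟩⟩ hne

/-- **Finite interpolation in the unit ball of `ℂ →ᵇ ℂ`**: prescribed values of modulus `≤ 1` at
finitely many points are taken by a bounded continuous function of norm `≤ 1` (sum of tents of a
separating radius: at every point at most one tent is non-zero). -/
theorem exists_bcf_interpolate (P : Finset ℂ) (c : ℂ → ℂ) (hc : ∀ w ∈ P, ‖c w‖ ≤ 1) :
    ∃ φ : ℂ →ᵇ ℂ, ‖φ‖ ≤ 1 ∧ ∀ w ∈ P, φ w = c w := by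
  classical
  obtain ⟨r, hr, hsep⟩ := exists_sep_radius P
  -- the tents `t w = max 0 (1 - dist · w / r)`
  set t : ℂ → ℂ → ℝ := fun w v => max 0 (1 - dist v w / r) with ht
  have ht0 : ∀ w v, 0 ≤ t w v := fun w v => le_max_left _ _
  have ht1 : ∀ w v, t w v ≤ 1 := fun w v =>
    max_le zero_le_one (by linarith [div_nonneg (dist_nonneg (x := v) (y := w)) hr.le])
  have htw : ∀ w, t w w = 1 := fun w => by simp [ht]
  have htlt : ∀ w v, 0 < t w v → dist v w < r := by
    intro w v h
    by_contra hge
    have hge := not_lt.1 hge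
    have h1 : 1 - dist v w / r ≤ 0 := by
      rw [sub_nonpos, le_div_iff₀ hr]; linarith
    have h2 : t w v = 0 := max_eq_left h1
    linarith
  have htne : ∀ w ∈ P, ∀ w' ∈ P, w ≠ w' → t w w' = 0 := by
    intro w hw w' hw' hne
    have h2 := hsep w hw w' hw' hne
    refine max_eq_left ?_
    rw [sub_nonpos, le_div_iff₀ hr, dist_comm]; linarith
  have htc : ∀ w, Continuous (t w) := fun w => by
    simp only [ht]
    fun_prop
  -- at most one tent is non-zero at a given point
  have hsum : ∀ v, ∑ w ∈ P, t w v ≤ 1 := by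
    intro v
    by_cases h : ∃ w ∈ P, 0 < t w v
    · obtain ⟨w₀, hw₀, hpos⟩ := h
      rw [Finset.sum_eq_single_of_mem w₀ hw₀]
      · exact ht1 w₀ v
      · intro w hw hne
        by_contra hz
        have hpos' : 0 < t w v := lt_of_le_of_ne (ht0 w v) (Ne.symm hz)
        have h1 := htlt w₀ v hpos
        have h2 := htlt w v hpos'
        have h3 := hsep w hw w₀ hw₀ hne
        have h4 := dist_triangle_left w w₀ v
        linarith
    · have h' : ∀ w ∈ P, t w v ≤ 0 := fun w hw => not_lt.1 fun hlt => h ⟨w, hw, hlt⟩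
      rw [Finset.sum_eq_zero fun w hw => le_antisymm (h' w hw) (ht0 w v)]
      exact zero_le_one
  -- the interpolant
  set f : ℂ → ℂ := fun v => ∑ w ∈ P, c w * (t w v : ℂ) with hf
  have hfc : Continuous f := by
    refine continuous_finsetSum _ fun w _ => continuous_const.mul ?_
    exact Complex.continuous_ofReal.comp (htc w)
  have hfb : ∀ v, ‖f v‖ ≤ 1 := by
    intro v
    calc ‖f v‖ ≤ ∑ w ∈ P, ‖c w * (t w v : ℂ)‖ := norm_sum_le _ _
      _ ≤ ∑ w ∈ P, t w v := Finset.sum_le_sum fun w hw => by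
          rw [norm_mul, Complex.norm_real, Real.norm_of_nonneg (ht0 w v)]
          exact mul_le_of_le_one_left (ht0 w v) (hc w hw)
      _ ≤ 1 := hsum v
  refine ⟨BoundedContinuousFunction.ofNormedAddCommGroup f hfc 1 hfb,
    BoundedContinuousFunction.norm_ofNormedAddCommGroup_le hfc zero_le_one hfb, fun w₀ hw₀ => ?_⟩
  show f w₀ = c w₀
  simp only [hf]
  rw [Finset.sum_eq_single_of_mem w₀ hw₀ fun w hw hne => by rw [htne w hw w₀ hw₀ hne]; simp, htw]
  simp

/-- **Dual-norm lower bound for finite sums of point evaluations.** If the points `p i`, `i ∈ S`,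
are distinct, the functional `T = Σ_{i ∈ S} a i · ev_{p i}` on `ℂ →ᵇ ℂ` has `Σ_{i ∈ S} ‖a i‖ ≤ ‖T‖`
(test `T` against the interpolant of the conjugate phases). -/
theorem sum_norm_le_opNorm_evalSum {ι : Type*} (S : Finset ι) (a : ι → ℂ) (p : ι → ℂ)
    (hp : Set.InjOn p S) :
    ∑ i ∈ S, ‖a i‖ ≤ ‖(∑ i ∈ S, a i • BoundedContinuousFunction.evalCLM ℂ (p i) : (ℂ →ᵇ ℂ) →L[ℂ] ℂ)‖ := by
  classical
  set T : (ℂ →ᵇ ℂ) →L[ℂ] ℂ := ∑ i ∈ S, a i • BoundedContinuousFunction.evalCLM ℂ (p i) with hT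
  set c : ℂ → ℂ := fun w => ∑ i ∈ S.filter (fun i => p i = w), conj (a i) / (‖a i‖ : ℂ) with hc
  have hc_at : ∀ i ∈ S, c (p i) = conj (a i) / (‖a i‖ : ℂ) := by
    intro i hi
    have hmem : i ∈ S.filter (fun j => p j = p i) := Finset.mem_filter.2 ⟨hi, rfl⟩
    simp only [hc]
    rw [Finset.sum_eq_single_of_mem i hmem]
    intro j hj hji
    exact absurd (hp (Finset.mem_filter.1 hj).1 hi (Finset.mem_filter.1 hj).2) hji
  have hc_norm : ∀ w ∈ S.image p, ‖c w‖ ≤ 1 := by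
    intro w hw
    obtain ⟨i, hi, rfl⟩ := Finset.mem_image.1 hw
    rw [hc_at i hi, norm_div, Complex.norm_conj, Complex.norm_real, Real.norm_of_nonneg (norm_nonneg _)]
    exact div_self_le_one _
  obtain ⟨φ, hφ, hφc⟩ := exists_bcf_interpolate (S.image p) c hc_norm
  have hTφ : T φ = ((∑ i ∈ S, ‖a i‖ : ℝ) : ℂ) := by
    simp only [hT, _root_.sum_apply, _root_.smul_apply, BoundedContinuousFunction.evalCLM_apply,
      smul_eq_mul]
    rw [Complex.ofReal_sum]
    refine Finset.sum_congr rfl fun i hi => ?_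
    rw [hφc (p i) (Finset.mem_image_of_mem p hi), hc_at i hi]
    by_cases ha : a i = 0
    · simp [ha]
    · have hn : (‖a i‖ : ℂ) ≠ 0 := by exact_mod_cast norm_ne_zero_iff.2 ha
      rw [mul_div_assoc', Complex.mul_conj, div_eq_iff hn, Complex.normSq_eq_norm_sq]
      push_cast; ring
  calc ∑ i ∈ S, ‖a i‖ = ‖T φ‖ := by
        rw [hTφ, Complex.norm_real,
          Real.norm_of_nonneg (Finset.sum_nonneg fun i _ => norm_nonneg _)]
    _ ≤ ‖T‖ * ‖φ‖ := T.le_opNorm φ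
    _ ≤ ‖T‖ * 1 := mul_le_mul_of_nonneg_left hφ (norm_nonneg _)
    _ = ‖T‖ := mul_one _

/-! ### 2. Distinct mid-edges of the honeycomb lattice have distinct midpoints -/

/-- Every edge of `ℍ` is `{(x,0), (x-d,1)}` with `d ∈ {0, e₀, e₁}` (bipartite normal form). -/
theorem exists_edge_rep {z : Sym2 HexVertex} (hz : z ∈ hexGraph.edgeSet) :
    ∃ x d : Site 2, (d = 0 ∨ d = Pi.single 0 1 ∨ d = Pi.single 1 1) ∧
      z = s(((x, 0) : HexVertex), ((x - d, 1) : HexVertex)) := by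
  induction z using Sym2.ind with
  | h f g =>
    rw [SimpleGraph.mem_edgeSet] at hz
    obtain ⟨x, k⟩ := f
    obtain ⟨y, l⟩ := g
    fin_cases k <;> fin_cases l <;> simp only [Fin.zero_eta, Fin.isValue, Fin.mk_one] at hz ⊢
    · exact absurd hz (not_hexGraph_adj_of_snd_eq_holds _ _ rfl)
    · rcases (hexGraph_adj_iff_of_snd_eq_zero_holds x y).1 hz with rfl | rfl | rfl
      · exact ⟨y, 0, Or.inl rfl, by rw [sub_zero]⟩
      · exact ⟨x, Pi.single 0 1, Or.inr (Or.inl rfl), rfl⟩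
      · exact ⟨x, Pi.single 1 1, Or.inr (Or.inr rfl), rfl⟩
    · rcases (hexGraph_adj_iff_of_snd_eq_zero_holds y x).1 hz.symm with rfl | rfl | rfl
      · exact ⟨x, 0, Or.inl rfl, by rw [sub_zero, Sym2.eq_swap]⟩
      · exact ⟨y, Pi.single 0 1, Or.inr (Or.inl rfl), Sym2.eq_swap⟩
      · exact ⟨y, Pi.single 1 1, Or.inr (Or.inr rfl), Sym2.eq_swap⟩
    · exact absurd hz (not_hexGraph_adj_of_snd_eq_holds _ _ rfl)

/-- Brick coordinates of a midpoint: `re = (pos u + pos v + 2)/4`,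
`im = (√3/4)(row u + row v + (u.2 + v.2 + 2)/3)`. -/
theorem hexMidpoint_coords (u v : HexVertex) :
    (hexMidpoint s(u, v)).re = ((pos u : ℝ) + pos v + 2) / 4 ∧
      (hexMidpoint s(u, v)).im =
        Real.sqrt 3 / 4 * ((row u : ℝ) + row v + ((((u.2 : ℕ) : ℝ) + ((v.2 : ℕ) : ℝ) + 2) / 3)) := by
  refine ⟨mid_re u v, ?_⟩
  rw [mid_im, hexCenter_im, hexCenter_im]; ring

/-- **`hexMidpoint` is injective on the edges of `ℍ`**: two mid-edges with the same midpoint are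
equal (the integers `pos u + pos v` and `row u + row v` of an edge `{u, v}` are read off the
midpoint, and they determine the edge in bipartite normal form by parity). -/
theorem hexMidpoint_injOn_edgeSet : Set.InjOn hexMidpoint hexGraph.edgeSet := by
  intro z hz z' hz' h
  obtain ⟨x, d, hd, rfl⟩ := exists_edge_rep hz
  obtain ⟨x', d', hd', rfl⟩ := exists_edge_rep hz'
  have hre := congrArg Complex.re h
  have him := congrArg Complex.im h
  rw [(hexMidpoint_coords _ _).1, (hexMidpoint_coords _ _).1] at hre
  rw [(hexMidpoint_coords _ _).2, (hexMidpoint_coords _ _).2] at him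
  have h34 : (0 : ℝ) < Real.sqrt 3 / 4 := by positivity
  have him' := mul_left_cancel₀ h34.ne' him
  simp only [Fin.isValue, Fin.val_zero, Fin.val_one, Nat.cast_zero, Nat.cast_one] at him'
  have hA : pos ((x, 0) : HexVertex) + pos ((x - d, 1) : HexVertex) =
      pos ((x', 0) : HexVertex) + pos ((x' - d', 1) : HexVertex) := by
    have : ((pos ((x, 0) : HexVertex) : ℝ) + pos ((x - d, 1) : HexVertex)) =
        (pos ((x', 0) : HexVertex) : ℝ) + pos ((x' - d', 1) : HexVertex) := by linarith
    exact_mod_cast this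
  have hB : row ((x, 0) : HexVertex) + row ((x - d, 1) : HexVertex) =
      row ((x', 0) : HexVertex) + row ((x' - d', 1) : HexVertex) := by
    have : ((row ((x, 0) : HexVertex) : ℝ) + row ((x - d, 1) : HexVertex)) =
        (row ((x', 0) : HexVertex) : ℝ) + row ((x' - d', 1) : HexVertex) := by linarith
    exact_mod_cast this
  have e00 : (Pi.single 0 1 : Site 2) 0 = 1 := by simp
  have e01 : (Pi.single 0 1 : Site 2) 1 = 0 := by simp
  have e10 : (Pi.single 1 1 : Site 2) 0 = 0 := by simp
  have e11 : (Pi.single 1 1 : Site 2) 1 = 1 := by simp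
  simp only [pos, row, Fin.isValue, Fin.val_zero, Fin.val_one, Nat.cast_zero, Nat.cast_one,
    Pi.sub_apply] at hA hB
  have key : x = x' ∧ d = d' := by
    rcases hd with rfl | rfl | rfl <;> rcases hd' with rfl | rfl | rfl <;>
      simp only [Pi.zero_apply, e00, e01, e10, e11] at hA hB <;>
      first
        | exact ⟨by ext i; fin_cases i <;> simp <;> omega, rfl⟩
        | (exfalso; omega)
  obtain ⟨rfl, rfl⟩ := key
  rfl

/-! ### 3. The necessity theorem -/

/-- **Local `L¹` law from eventual boundedness of the normalised functionals (Banach–Steinhaus).**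
For a fixed family `Λ, e, b`, an open `U`, `F_δ(b δ) ≠ 0` eventually, and `‖N_δ(ψ)‖` eventually
bounded along `𝓝[>] 0` for every continuous compactly supported `ψ` with `tsupport ψ ⊆ U`: for every
compact `K ⊆ U`, `∃ C, ∀ᶠ δ, δ² Σ_{z ∈ Ω_δ, δ·mid z ∈ K} ‖F_δ(z)‖ ≤ C ‖F_δ(b δ)‖`. -/
theorem localL1Bound_of_eventually_bounded (Λ : ℝ → Finset HexVertex) (e b : ℝ → Sym2 HexVertex)
    {U : Set ℂ} (hU : IsOpen U)
    (hb : ∀ᶠ δ : ℝ in 𝓝[>] 0,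
      hexParafermionicObservable (Λ δ) (e δ) hexCriticalFugacity (5 / 8) (b δ) ≠ 0)
    (hN : ∀ ψ : ℂ → ℂ, Continuous ψ → HasCompactSupport ψ → tsupport ψ ⊆ U →
      ∃ M : ℝ, ∀ᶠ δ : ℝ in 𝓝[>] 0,
        ‖(δ : ℂ) ^ 2 * (∑ᶠ z ∈ hexDomainMidEdges (Λ δ), ψ ((δ : ℂ) * hexMidpoint z) *
            hexParafermionicObservable (Λ δ) (e δ) hexCriticalFugacity (5 / 8) z) /
          hexParafermionicObservable (Λ δ) (e δ) hexCriticalFugacity (5 / 8) (b δ)‖ ≤ M)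
    {K : Set ℂ} (hK : IsCompact K) (hKU : K ⊆ U) :
    ∃ C : ℝ, ∀ᶠ δ : ℝ in 𝓝[>] 0,
      δ ^ 2 * (∑ᶠ z ∈ {z : Sym2 HexVertex | z ∈ hexDomainMidEdges (Λ δ) ∧
          (δ : ℂ) * hexMidpoint z ∈ K},
        ‖hexParafermionicObservable (Λ δ) (e δ) hexCriticalFugacity (5 / 8) z‖) ≤
      C * ‖hexParafermionicObservable (Λ δ) (e δ) hexCriticalFugacity (5 / 8) (b δ)‖ := by
  classical
  set F : ℝ → Sym2 HexVertex → ℂ := fun δ z =>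
    hexParafermionicObservable (Λ δ) (e δ) hexCriticalFugacity (5 / 8) z with hFdef
  -- cutoff `χ`: `= 1` on `K`, `= 0` off the interior of a compact `L ⊆ U`
  obtain ⟨L, hLc, hKL, hLU⟩ := exists_compact_between hK hU hKU
  obtain ⟨χ, hχK, hχL, -, hχ01⟩ := exists_continuous_one_zero_of_isCompact hK
    isOpen_interior.isClosed_compl (disjoint_compl_right_iff_subset.2 hKL)
  have hsuppL : Function.support χ ⊆ L := fun w hw =>
    interior_subset (Classical.by_contradiction fun h' => hw (hχL h'))
  have hχU : tsupport χ ⊆ U := (closure_minimal hsuppL hLc.isClosed).trans hLU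
  have hχcpt : HasCompactSupport χ := HasCompactSupport.intro' hLc hLc.isClosed
    fun w hw => Function.notMem_support.1 fun h' => hw (hsuppL h')
  by_contra hcon
  -- a violating sequence `δ_n → 0⁺`
  have hex : ∀ n : ℕ, ∃ δ : ℝ,
      ¬ (δ ^ 2 * (∑ᶠ z ∈ {z : Sym2 HexVertex | z ∈ hexDomainMidEdges (Λ δ) ∧
          (δ : ℂ) * hexMidpoint z ∈ K}, ‖F δ z‖) ≤ n * ‖F δ (b δ)‖) ∧
        F δ (b δ) ≠ 0 ∧ δ ∈ Set.Ioo (0 : ℝ) (1 / ((n : ℝ) + 1)) := fun n =>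
    ((Filter.not_eventually.1 fun h' => hcon ⟨n, h'⟩).and_eventually
      (hb.and (Ioo_mem_nhdsGT (by positivity)))).exists
  choose δs hδs using hex
  have hδpos : ∀ n, 0 < δs n := fun n => (hδs n).2.2.1
  have hT0 : Tendsto δs atTop (𝓝 0) :=
    tendsto_of_tendsto_of_tendsto_of_le_of_le tendsto_const_nhds
      tendsto_one_div_add_atTop_nhds_zero_nat (fun n => (hδpos n).le) fun n => (hδs n).2.2.2.le
  have hTw : Tendsto δs atTop (𝓝[>] 0) :=
    tendsto_nhdsWithin_iff.2 ⟨hT0, Filter.Eventually.of_forall fun n => hδpos n⟩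
  -- the functionals `T_n φ = N_{δ_n}(χ φ)` on `ℂ →ᵇ ℂ`
  set S : ℕ → Finset (Sym2 HexVertex) := fun n => (hexDomainMidEdges_finite (Λ (δs n))).toFinset
    with hSdef
  set p : ℕ → Sym2 HexVertex → ℂ := fun n z => ((δs n : ℝ) : ℂ) * hexMidpoint z with hpdef
  set a : ℕ → Sym2 HexVertex → ℂ := fun n z =>
    ((δs n : ℝ) : ℂ) ^ 2 * ((χ (p n z) : ℝ) : ℂ) * F (δs n) z / F (δs n) (b (δs n)) with hadef
  set T : ℕ → (ℂ →ᵇ ℂ) →L[ℂ] ℂ := fun n =>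
    ∑ z ∈ S n, a n z • BoundedContinuousFunction.evalCLM ℂ (p n z) with hTdef
  have hSmem : ∀ n z, z ∈ S n ↔ z ∈ hexDomainMidEdges (Λ (δs n)) := fun n z => by
    simp only [hSdef, Set.Finite.mem_toFinset]
  have hTapply : ∀ n (φ : ℂ →ᵇ ℂ), T n φ = ((δs n : ℝ) : ℂ) ^ 2 *
      (∑ᶠ z ∈ hexDomainMidEdges (Λ (δs n)),
        (((χ (((δs n : ℝ) : ℂ) * hexMidpoint z) : ℝ) : ℂ) * φ (((δs n : ℝ) : ℂ) * hexMidpoint z)) *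
          F (δs n) z) / F (δs n) (b (δs n)) := by
    intro n φ
    rw [finsum_mem_eq_finite_toFinset_sum _ (hexDomainMidEdges_finite _), Finset.mul_sum,
      Finset.sum_div]
    simp only [hTdef, _root_.sum_apply, _root_.smul_apply, BoundedContinuousFunction.evalCLM_apply,
      smul_eq_mul, hadef, hpdef, hSdef]
    refine Finset.sum_congr rfl fun z _ => ?_
    ring
  -- pointwise boundedness: `χ φ` is an admissible test function
  have hpt : ∀ φ : ℂ →ᵇ ℂ, ∃ C, ∀ n, ‖T n φ‖ ≤ C := by
    intro φ
    have hψc : Continuous fun w => ((χ w : ℝ) : ℂ) * φ w :=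
      (Complex.continuous_ofReal.comp χ.continuous).mul φ.continuous
    have h1 : HasCompactSupport fun w => ((χ w : ℝ) : ℂ) := hχcpt.comp_left Complex.ofReal_zero
    have hψs : HasCompactSupport fun w => ((χ w : ℝ) : ℂ) * φ w := h1.mul_right
    have hψU : tsupport (fun w => ((χ w : ℝ) : ℂ) * φ w) ⊆ U := by
      refine tsupport_mul_subset_left.trans (subset_trans ?_ hχU)
      exact closure_mono (Function.support_comp_subset Complex.ofReal_zero _)
    obtain ⟨M, hM⟩ := hN _ hψc hψs hψU
    have hev : ∀ᶠ n in atTop, ‖T n φ‖ ≤ M := by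
      filter_upwards [hTw.eventually hM] with n hn
      rwa [hTapply n φ]
    obtain ⟨C, hC⟩ := (isBoundedUnder_of_eventually_le hev).bddAbove_range
    exact ⟨C, fun n => hC (Set.mem_range_self n)⟩
  obtain ⟨C', hC'⟩ := banach_steinhaus (g := T) hpt
  -- lower bound of the dual norms by the local `L¹` masses
  have hlow : ∀ n, (δs n) ^ 2 * (∑ᶠ z ∈ {z : Sym2 HexVertex | z ∈ hexDomainMidEdges (Λ (δs n)) ∧
      ((δs n : ℝ) : ℂ) * hexMidpoint z ∈ K}, ‖F (δs n) z‖) ≤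
        C' * ‖F (δs n) (b (δs n))‖ := by
    intro n
    have hinj : Set.InjOn (p n) (S n) := by
      intro z hz z' hz' hzz'
      have hδ0 : ((δs n : ℝ) : ℂ) ≠ 0 := Complex.ofReal_ne_zero.2 (hδpos n).ne'
      exact hexMidpoint_injOn_edgeSet ((hSmem n z).1 hz).1 ((hSmem n z').1 hz').1
        (mul_left_cancel₀ hδ0 hzz')
    have key := (sum_norm_le_opNorm_evalSum (S n) (a n) (p n) hinj).trans (hC' n)
    have hFb : 0 < ‖F (δs n) (b (δs n))‖ := norm_pos_iff.2 (hδs n).2.1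
    have hset : {z : Sym2 HexVertex | z ∈ hexDomainMidEdges (Λ (δs n)) ∧
        ((δs n : ℝ) : ℂ) * hexMidpoint z ∈ K} = ↑((S n).filter fun z => p n z ∈ K) := by
      ext z
      simp only [Set.mem_setOf_eq, Finset.coe_filter, hSmem, hpdef]
    rw [hset, finsum_mem_coe_finset]
    calc (δs n) ^ 2 * ∑ z ∈ (S n).filter (fun z => p n z ∈ K), ‖F (δs n) z‖
        = ∑ z ∈ (S n).filter (fun z => p n z ∈ K), ‖F (δs n) (b (δs n))‖ * ‖a n z‖ := by
          rw [Finset.mul_sum]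
          refine Finset.sum_congr rfl fun z hz => ?_
          have hzK : p n z ∈ K := (Finset.mem_filter.1 hz).2
          have hχ1 : χ (p n z) = 1 := hχK hzK
          simp only [hadef, hχ1, Complex.ofReal_one, mul_one, norm_div, norm_mul, norm_pow,
            Complex.norm_real, Real.norm_of_nonneg (hδpos n).le]
          field_simp
      _ ≤ ∑ z ∈ S n, ‖F (δs n) (b (δs n))‖ * ‖a n z‖ :=
          Finset.sum_le_sum_of_subset_of_nonneg (Finset.filter_subset _ _)
            fun z _ _ => by positivity
      _ = ‖F (δs n) (b (δs n))‖ * ∑ z ∈ S n, ‖a n z‖ := (Finset.mul_sum _ _ _).symm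
      _ ≤ ‖F (δs n) (b (δs n))‖ * C' := mul_le_mul_of_nonneg_left key hFb.le
      _ = C' * ‖F (δs n) (b (δs n))‖ := mul_comm _ _
  -- contradiction at `n ≥ C'`
  obtain ⟨n, hn⟩ := exists_nat_gt C'
  have hFb : 0 ≤ ‖F (δs n) (b (δs n))‖ := norm_nonneg _
  exact (hδs n).1 ((hlow n).trans (mul_le_mul_of_nonneg_right hn.le hFb))

/-- **Registered sub-goal `stub_localL1Bound_necessity`** (crux item stmt-CriticalPhenomena-14004,
lines `pick-half-plane` / `dressed-arrival-cauchy-transform`, stub `stub_localL1Bound`): the local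
`L¹` law `LocalL1Bound` is NECESSARY for the convergence of the normalised bulk functionals against
continuous test functions — for a fixed family `Λ, e, b` and an open `U`, eventual non-vanishing of
the normaliser and eventual boundedness of `‖N_δ(ψ)‖` for every continuous compactly supported `ψ`
with `tsupport ψ ⊆ U` already force `δ² Σ_{δ·mid z ∈ K} ‖F_δ(z)‖ ≤ C ‖F_δ(b δ)‖` eventually, for
every compact `K ⊆ U` (Banach–Steinhaus on `ℂ →ᵇ ℂ`). -/
theorem stub_localL1Bound_necessity : ∀ (Λ : ℝ → Finset HexVertex) (e b : ℝ → Sym2 HexVertex) (U : Set ℂ), IsOpen U → (∀ᶠ δ : ℝ in 𝓝[>] 0, hexParafermionicObservable (Λ δ) (e δ) hexCriticalFugacity (5 / 8) (b δ) ≠ 0) → (∀ ψ : ℂ → ℂ, Continuous ψ → HasCompactSupport ψ → tsupport ψ ⊆ U → ∃ M : ℝ, ∀ᶠ δ : ℝ in 𝓝[>] 0, ‖(δ : ℂ) ^ 2 * (∑ᶠ z ∈ hexDomainMidEdges (Λ δ), ψ ((δ : ℂ) * hexMidpoint z) * hexParafermionicObservable (Λ δ) (e δ) hexCriticalFugacity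 (5 / 8) z) / hexParafermionicObservable (Λ δ) (e δ) hexCriticalFugacity (5 / 8) (b δ)‖ ≤ M) → ∀ K : Set ℂ, IsCompact K → K ⊆ U → ∃ C : ℝ, ∀ᶠ δ : ℝ in 𝓝[>] 0, δ ^ 2 * (∑ᶠ z ∈ {z : Sym2 HexVertex | z ∈ hexDomainMidEdges (Λ δ) ∧ (δ : ℂ) * hexMidpoint z ∈ K}, ‖hexParafermionicObservable (Λ δ) (e δ) hexCriticalFugacity (5 / 8) z‖) ≤ C * ‖hexParafermionicObservable (Λ δ) (e δ) hexCriticalFugacity (5 / 8) (b δ)‖ :=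
  fun Λ e b _ hU hb hN _ hK hKU => localL1Bound_of_eventually_bounded Λ e b hU hb hN hK hKU

end Summit.CriticalPhenomena.SAWScalingLimit.Theorems.PickHalfPlane.LocalL1

end
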